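import Summits.Ventures.LatticeQCDFlow.Exactness.Phi4MetropolisStepLawComparison
import Summits.Ventures.LatticeQCDFlow.Exactness.Phi4MetropolisMagnetisationMomentCSD
import HarnessLib

/-!
# The certified step-size trade-off of the local arm: doubling the window (or the proposal width) can slow any observable by at most a factor two in `τ_int + ½`

HONEST FRAMING: exact (Metropolis-corrected) sampling algorithms for lattice gauge theory;
figures of merit are autocorrelation/cost numbers at stated couplings and volumes; no
continuum-physics claim.  (SCALAR calibration rung S0-A: not a gauge result.)

Venture `LatticeQCDFlow` (cell pub-lqcd), topic `Exactness`; FANOUT row 2 (`s0-phi4`, LOCAL arm).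
NEW WORK of the cell: the two concrete instances of `Exactness/Phi4MetropolisStepLawComparison.lean`
(step-law domination `ρ₁ ≤ c ρ₂` ⇒ `τ_int,ρ₂ + ½ ≤ c (τ_int,ρ₁ + ½)`, from the comparison theorem
`Exactness/ReversibleComparison.lean`) for the two proposal families of the S0-A local arm: the
engine's uniform WINDOW `U[−δ, δ]` and GAUSSIAN steps `N(0, v)` (`Phi4MetropolisMagnetisationMomentCSD`).
Nothing is cited as a fact; the window density is written out as an indicator, no definition added.

## What is proved (lattice φ⁴ on `V = n+1` sites, coercive action — every `λ > 0`, real `J`;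
## `f ∈ PolyObs`, `g = f − ⟨f⟩`, `τ_int` per proposal, `Scoring.tauInt`)

* `uniformWindow_*` — the density `u ↦ 1_{[−δ,δ]}(u)/(2δ)` (`δ > 0`) is a nonnegative, even,
  measurable probability density with all moments, and **`U[−δ,δ] ≤ (δ'/δ) · U[−δ',δ']`** pointwise
  for `δ ≤ δ'`;
* `gaussianPDFReal_le_mul_of_le` — **`N(0,v₁) ≤ √(v₂/v₁) · N(0,v₂)`** pointwise for `0 < v₁ ≤ v₂`;
* **`metropolisScan_abelSum_le_window`**, **`metropolisScan_tauInt_add_half_le_window`** —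
  windows `δ ≤ δ'`: unconditionally `Σ_k C_{g,δ'}(k) sᵏ ≤ (1 − r + r δ'/δ) Σ_k C_{g,δ}(k) rᵏ`
  (`s = (rδ'/δ)/(1 − r + rδ'/δ)`), and under the standing summability hypothesis
  **`τ_int,δ'(f) + ½ ≤ (δ'/δ) · (τ_int,δ(f) + ½)`**;
* **`metropolisScan_tauInt_add_half_le_gaussian`** — Gaussian steps `v₁ ≤ v₂`:
  **`τ_int,v₂(f) + ½ ≤ √(v₂/v₁) · (τ_int,v₁(f) + ½)`**.

Reading (no numerics implied).  Per site update, ENLARGING the proposal by a factor `κ` in width can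
slow an observable — any observable: `M`, `S`, a phase label — by at most the factor `κ` in
`τ_int + ½`; this linear law is exactly what the rejection-dominated regime realises (acceptance
`∝ 1/width`), so it is the sharp large-step counterpart of gen-13's small-step floor
`τ_sweep(M) ≥ 2χ/m₂ − ½` (`m₂ = δ²/3`, `v`): between them the certified picture of the step-size
trade-off `δ²ā(δ)` of HOME/s0-phi4/CSD-THEOREMS.md row I.  Equivalently, SHRINKING the window by `κ`
can GAIN at most the factor `κ`.  NOT CLAIMED: per-sweep (thinned) forms; the ordered sweep; that
either bound is attained for a given run; any number for any run.
-/

namespace Summit.Ventures.LatticeQCDFlow.Exactness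

open Real MeasureTheory Filter Finset Set ProbabilityTheory
open Summit.Ventures.LatticeQCDFlow.Scoring

/-! ## §1 The uniform window density `1_{[−δ,δ]}/(2δ)` -/

section Window

/-- The window density `1_{[−δ,δ]}/(2δ)` is nonnegative (`δ > 0`). -/
theorem uniformWindow_nonneg (δ : ℝ) (hδ : 0 < δ) (u : ℝ) :
    0 ≤ (Icc (-δ) δ).indicator (fun _ => (2 * δ)⁻¹) u :=
  Set.indicator_nonneg (fun _ _ => by positivity) u

/-- The window density is measurable. -/
theorem uniformWindow_measurable (δ : ℝ) :
    Measurable ((Icc (-δ) δ).indicator fun _ : ℝ => (2 * δ)⁻¹) :=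
  measurable_const.indicator measurableSet_Icc

/-- The window density is integrable (bounded with compact support). -/
theorem uniformWindow_integrable (δ : ℝ) :
    Integrable ((Icc (-δ) δ).indicator fun _ : ℝ => (2 * δ)⁻¹) :=
  (integrable_indicator_iff measurableSet_Icc).2 (integrableOn_const (by
    rw [Real.volume_Icc]; exact ENNReal.ofReal_ne_top))

/-- The window density has total mass one: `∫ 1_{[−δ,δ]}/(2δ) = 1` (`δ > 0`). -/
theorem uniformWindow_integral {δ : ℝ} (hδ : 0 < δ) :
    ∫ u, (Icc (-δ) δ).indicator (fun _ : ℝ => (2 * δ)⁻¹) u = 1 := by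
  rw [integral_indicator_const _ measurableSet_Icc, Real.volume_real_Icc_of_le (by linarith),
    smul_eq_mul]
  field_simp
  ring

/-- The window density is even. -/
theorem uniformWindow_even (δ u : ℝ) :
    (Icc (-δ) δ).indicator (fun _ : ℝ => (2 * δ)⁻¹) (-u)
      = (Icc (-δ) δ).indicator (fun _ : ℝ => (2 * δ)⁻¹) u := by
  by_cases hu : u ∈ Icc (-δ) δ
  · have hu' : -u ∈ Icc (-δ) δ := ⟨by linarith [hu.2], by linarith [hu.1]⟩
    rw [indicator_of_mem hu, indicator_of_mem hu']
  · have hu' : -u ∉ Icc (-δ) δ := fun h => hu ⟨by linarith [h.2], by linarith [h.1]⟩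
    rw [indicator_of_notMem hu, indicator_of_notMem hu']

/-- The window density vanishes outside `[−δ, δ]`. -/
theorem uniformWindow_eq_zero {δ u : ℝ} (hu : δ < |u|) :
    (Icc (-δ) δ).indicator (fun _ : ℝ => (2 * δ)⁻¹) u = 0 := by
  have hu' : u ∉ Icc (-δ) δ := fun h => by
    have : |u| ≤ δ := abs_le.2 ⟨h.1, h.2⟩
    linarith
  rw [indicator_of_notMem hu']

/-- The window density has all moments `∫ (1+|u|)^j ρ(u) du < ∞`. -/
theorem uniformWindow_moments {δ : ℝ} (hδ : 0 < δ) (j : ℕ) :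
    Integrable (fun u => (1 + |u|) ^ j * (Icc (-δ) δ).indicator (fun _ : ℝ => (2 * δ)⁻¹) u) :=
  window_moments (uniformWindow_nonneg δ hδ) (uniformWindow_measurable δ) (uniformWindow_integrable δ)
    (fun _ hu => uniformWindow_eq_zero hu) j

/-- **`U[−δ, δ] ≤ (δ'/δ) · U[−δ', δ']`** pointwise for `0 < δ ≤ δ'`. -/
theorem uniformWindow_le_mul {δ δ' : ℝ} (hδ : 0 < δ) (hδδ' : δ ≤ δ') (u : ℝ) :
    (Icc (-δ) δ).indicator (fun _ : ℝ => (2 * δ)⁻¹) u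
      ≤ (δ' / δ) * (Icc (-δ') δ').indicator (fun _ : ℝ => (2 * δ')⁻¹) u := by
  have hδ' : 0 < δ' := lt_of_lt_of_le hδ hδδ'
  by_cases hu : u ∈ Icc (-δ) δ
  · have hu' : u ∈ Icc (-δ') δ' := ⟨by linarith [hu.1], by linarith [hu.2]⟩
    rw [indicator_of_mem hu, indicator_of_mem hu']
    rw [show (δ' / δ) * (2 * δ')⁻¹ = (2 * δ)⁻¹ by field_simp]
  · rw [indicator_of_notMem hu]
    exact mul_nonneg (div_nonneg hδ'.le hδ.le) (uniformWindow_nonneg δ' hδ' u)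

end Window

/-! ## §2 Gaussian step laws -/

/-- **`N(0, v₁) ≤ √(v₂/v₁) · N(0, v₂)`** pointwise for `0 < v₁ ≤ v₂`. -/
theorem gaussianPDFReal_le_mul_of_le {v₁ v₂ : NNReal} (hv₁ : v₁ ≠ 0) (h12 : v₁ ≤ v₂) (u : ℝ) :
    gaussianPDFReal 0 v₁ u ≤ Real.sqrt ((v₂ : ℝ) / v₁) * gaussianPDFReal 0 v₂ u := by
  have hv1 : (0 : ℝ) < v₁ := NNReal.coe_pos.2 (pos_iff_ne_zero.2 hv₁)
  have hv2 : (0 : ℝ) < v₂ := lt_of_lt_of_le hv1 (NNReal.coe_le_coe.2 h12)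
  have h12' : (v₁ : ℝ) ≤ v₂ := NNReal.coe_le_coe.2 h12
  simp only [gaussianPDFReal, sub_zero]
  have hexp : rexp (-u ^ 2 / (2 * (v₁ : ℝ))) ≤ rexp (-u ^ 2 / (2 * (v₂ : ℝ))) := by
    rw [Real.exp_le_exp, neg_div, neg_div, neg_le_neg_iff]
    exact div_le_div_of_nonneg_left (sq_nonneg u) (by positivity) (by linarith)
  have hconst : Real.sqrt ((v₂ : ℝ) / v₁) * (Real.sqrt (2 * π * (v₂ : ℝ)))⁻¹
      = (Real.sqrt (2 * π * (v₁ : ℝ)))⁻¹ := by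
    rw [← Real.sqrt_inv, ← Real.sqrt_inv, ← Real.sqrt_mul (div_nonneg hv2.le hv1.le)]
    congr 1
    field_simp
  calc (Real.sqrt (2 * π * (v₁ : ℝ)))⁻¹ * rexp (-u ^ 2 / (2 * (v₁ : ℝ)))
      ≤ (Real.sqrt (2 * π * (v₁ : ℝ)))⁻¹ * rexp (-u ^ 2 / (2 * (v₂ : ℝ))) :=
        mul_le_mul_of_nonneg_left hexp (by positivity)
    _ = Real.sqrt ((v₂ : ℝ) / v₁) * ((Real.sqrt (2 * π * (v₂ : ℝ)))⁻¹
          * rexp (-u ^ 2 / (2 * (v₂ : ℝ)))) := by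
        rw [← hconst]; ring

/-! ## §3 The comparisons -/

section Lattice

variable {n : ℕ}

/-- **WINDOWS, ABEL FORM (unconditional).**  `0 < δ ≤ δ'`, `g ∈ PolyObs`, `0 ≤ r < 1`, `c = δ'/δ`,
`s = r c/(1 − r + r c)`:  `Σ_k C_{g,δ'}(k) sᵏ ≤ (1 − r + r c) · Σ_k C_{g,δ}(k) rᵏ`. -/
theorem metropolisScan_abelSum_le_window {J : Fin (n + 1) → Fin (n + 1) → ℝ} {lam ε K : ℝ}
    (hε : 0 < ε) (hS : ∀ φ : Fin (n + 1) → ℝ, ε * ∑ w, φ w ^ 2 - K ≤ latticePhi4Action J lam φ)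
    {δ δ' : ℝ} (hδ : 0 < δ) (hδδ' : δ ≤ δ')
    {g : (Fin (n + 1) → ℝ) → ℝ} (hg : PolyObs g) {r : ℝ} (hr0 : 0 ≤ r) (hr1 : r < 1) :
    ∑' k, (∫ φ, g φ * ((metroScan J lam ((Icc (-δ') δ').indicator fun _ : ℝ => (2 * δ')⁻¹))^[k] g) φ
        * gibbsWeight J lam φ) * (r * (δ' / δ) / (1 - r + r * (δ' / δ))) ^ k
      ≤ (1 - r + r * (δ' / δ))
        * ∑' k, (∫ φ, g φ * ((metroScan J lam ((Icc (-δ) δ).indicator fun _ : ℝ => (2 * δ)⁻¹))^[k] g) φ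
          * gibbsWeight J lam φ) * r ^ k := by
  have hδ' : 0 < δ' := lt_of_lt_of_le hδ hδδ'
  exact metropolisScan_abelSum_le_of_stepLaw_le hε hS
    (uniformWindow_nonneg δ hδ) (uniformWindow_measurable δ) (uniformWindow_integrable δ)
    (uniformWindow_integral hδ) (fun u => uniformWindow_even δ u) (uniformWindow_moments hδ)
    (uniformWindow_nonneg δ' hδ') (uniformWindow_measurable δ') (uniformWindow_integrable δ')
    (uniformWindow_integral hδ') (fun u => uniformWindow_even δ' u) (uniformWindow_moments hδ')
    (div_pos hδ' hδ) (uniformWindow_le_mul hδ hδδ') hg hr0 hr1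

/-- **THE WINDOW LAW OF THE LOCAL ARM.**  Lattice φ⁴, coercive action (every `λ > 0`, real `J`);
random-site-scan Metropolis with uniform windows `U[−δ, δ]` and `U[−δ', δ']`, `0 < δ ≤ δ'`;
`f ∈ PolyObs` with `Var f > 0`, `g = f − ⟨f⟩`, normalised autocorrelation series summable under both
scans (proposal units).  Then  `τ_int,δ'(f) + ½ ≤ (δ'/δ) · (τ_int,δ(f) + ½)`. -/
theorem metropolisScan_tauInt_add_half_le_window {J : Fin (n + 1) → Fin (n + 1) → ℝ}
    {lam ε K : ℝ}
    (hε : 0 < ε) (hS : ∀ φ : Fin (n + 1) → ℝ, ε * ∑ w, φ w ^ 2 - K ≤ latticePhi4Action J lam φ)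
    {δ δ' : ℝ} (hδ : 0 < δ) (hδδ' : δ ≤ δ')
    {f : (Fin (n + 1) → ℝ) → ℝ} (hf : PolyObs f)
    (hP : 0 < ∫ φ, (f φ - gibbsExpect J lam f) ^ 2 * gibbsWeight J lam φ)
    (hs₁ : Summable fun k => (∫ φ, (f φ - gibbsExpect J lam f)
        * ((metroScan J lam ((Icc (-δ) δ).indicator fun _ : ℝ => (2 * δ)⁻¹))^[k + 1]
            (fun ψ => f ψ - gibbsExpect J lam f)) φ * gibbsWeight J lam φ)
        / ∫ φ, (f φ - gibbsExpect J lam f) ^ 2 * gibbsWeight J lam φ)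
    (hs₂ : Summable fun k => (∫ φ, (f φ - gibbsExpect J lam f)
        * ((metroScan J lam ((Icc (-δ') δ').indicator fun _ : ℝ => (2 * δ')⁻¹))^[k + 1]
            (fun ψ => f ψ - gibbsExpect J lam f)) φ * gibbsWeight J lam φ)
        / ∫ φ, (f φ - gibbsExpect J lam f) ^ 2 * gibbsWeight J lam φ) :
    tauInt (fun k => (∫ φ, (f φ - gibbsExpect J lam f)
          * ((metroScan J lam ((Icc (-δ') δ').indicator fun _ : ℝ => (2 * δ')⁻¹))^[k]
              (fun ψ => f ψ - gibbsExpect J lam f)) φ * gibbsWeight J lam φ)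
          / ∫ φ, (f φ - gibbsExpect J lam f) ^ 2 * gibbsWeight J lam φ) + 1 / 2
      ≤ (δ' / δ) * (tauInt (fun k => (∫ φ, (f φ - gibbsExpect J lam f)
          * ((metroScan J lam ((Icc (-δ) δ).indicator fun _ : ℝ => (2 * δ)⁻¹))^[k]
              (fun ψ => f ψ - gibbsExpect J lam f)) φ * gibbsWeight J lam φ)
          / ∫ φ, (f φ - gibbsExpect J lam f) ^ 2 * gibbsWeight J lam φ) + 1 / 2) := by
  have hδ' : 0 < δ' := lt_of_lt_of_le hδ hδδ'
  exact metropolisScan_tauInt_add_half_le_of_stepLaw_le hε hS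
    (uniformWindow_nonneg δ hδ) (uniformWindow_measurable δ) (uniformWindow_integrable δ)
    (uniformWindow_integral hδ) (fun u => uniformWindow_even δ u) (uniformWindow_moments hδ)
    (uniformWindow_nonneg δ' hδ') (uniformWindow_measurable δ') (uniformWindow_integrable δ')
    (uniformWindow_integral hδ') (fun u => uniformWindow_even δ' u) (uniformWindow_moments hδ')
    (div_pos hδ' hδ) (uniformWindow_le_mul hδ hδδ') hf hP hs₁ hs₂

/-- **THE GAUSSIAN-WIDTH LAW OF THE LOCAL ARM.**  The same with Gaussian steps `N(0, v₁)`,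
`N(0, v₂)`, `0 < v₁ ≤ v₂`:  `τ_int,v₂(f) + ½ ≤ √(v₂/v₁) · (τ_int,v₁(f) + ½)`. -/
theorem metropolisScan_tauInt_add_half_le_gaussian {J : Fin (n + 1) → Fin (n + 1) → ℝ}
    {lam ε K : ℝ}
    (hε : 0 < ε) (hS : ∀ φ : Fin (n + 1) → ℝ, ε * ∑ w, φ w ^ 2 - K ≤ latticePhi4Action J lam φ)
    {v₁ v₂ : NNReal} (hv₁ : v₁ ≠ 0) (h12 : v₁ ≤ v₂)
    {f : (Fin (n + 1) → ℝ) → ℝ} (hf : PolyObs f)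
    (hP : 0 < ∫ φ, (f φ - gibbsExpect J lam f) ^ 2 * gibbsWeight J lam φ)
    (hs₁ : Summable fun k => (∫ φ, (f φ - gibbsExpect J lam f)
        * ((metroScan J lam (gaussianPDFReal 0 v₁))^[k + 1]
            (fun ψ => f ψ - gibbsExpect J lam f)) φ * gibbsWeight J lam φ)
        / ∫ φ, (f φ - gibbsExpect J lam f) ^ 2 * gibbsWeight J lam φ)
    (hs₂ : Summable fun k => (∫ φ, (f φ - gibbsExpect J lam f)
        * ((metroScan J lam (gaussianPDFReal 0 v₂))^[k + 1]
            (fun ψ => f ψ - gibbsExpect J lam f)) φ * gibbsWeight J lam φ)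
        / ∫ φ, (f φ - gibbsExpect J lam f) ^ 2 * gibbsWeight J lam φ) :
    tauInt (fun k => (∫ φ, (f φ - gibbsExpect J lam f)
          * ((metroScan J lam (gaussianPDFReal 0 v₂))^[k]
              (fun ψ => f ψ - gibbsExpect J lam f)) φ * gibbsWeight J lam φ)
          / ∫ φ, (f φ - gibbsExpect J lam f) ^ 2 * gibbsWeight J lam φ) + 1 / 2
      ≤ Real.sqrt ((v₂ : ℝ) / v₁) * (tauInt (fun k => (∫ φ, (f φ - gibbsExpect J lam f)
          * ((metroScan J lam (gaussianPDFReal 0 v₁))^[k]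
              (fun ψ => f ψ - gibbsExpect J lam f)) φ * gibbsWeight J lam φ)
          / ∫ φ, (f φ - gibbsExpect J lam f) ^ 2 * gibbsWeight J lam φ) + 1 / 2) := by
  have hv₂ : v₂ ≠ 0 := fun h => hv₁ (nonpos_iff_eq_zero.1 (h ▸ h12))
  have hv1 : (0 : ℝ) < v₁ := NNReal.coe_pos.2 (pos_iff_ne_zero.2 hv₁)
  have hv2 : (0 : ℝ) < v₂ := NNReal.coe_pos.2 (pos_iff_ne_zero.2 hv₂)
  exact metropolisScan_tauInt_add_half_le_of_stepLaw_le hε hS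
    (fun u => gaussianPDFReal_nonneg 0 v₁ u) (measurable_gaussianPDFReal 0 v₁)
    (integrable_gaussianPDFReal 0 v₁) (integral_gaussianPDFReal_eq_one 0 hv₁)
    (gaussianPDFReal_zero_neg v₁) (gaussianPDFReal_moments hv₁)
    (fun u => gaussianPDFReal_nonneg 0 v₂ u) (measurable_gaussianPDFReal 0 v₂)
    (integrable_gaussianPDFReal 0 v₂) (integral_gaussianPDFReal_eq_one 0 hv₂)
    (gaussianPDFReal_zero_neg v₂) (gaussianPDFReal_moments hv₂)
    (Real.sqrt_pos.2 (div_pos hv2 hv1)) (gaussianPDFReal_le_mul_of_le hv₁ h12) hf hP hs₁ hs₂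

end Lattice

end Summit.Ventures.LatticeQCDFlow.Exactness
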